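import Literature.AlgebraicGeometry.Frobenioids.UnitWiseFrobenius
import Mathlib.CategoryTheory.Comma.Arrow
import HarnessLib

/-!
# Frobenioids I, Corollary 2.6 (unit-wise Frobenius functors), part 2: property (b)

Mochizuki, *The geometry of Frobenioids I: the general theory*, Kyushu J. Math. **62** (2008)
293–400, §2, Corollary 2.6 (b) and its proof, kurims text pp. 50–51
[cite: MochizukiFrdI2008, Cor. 2.6 p.50]: "(b) `Ψ` maps an object (respectively, morphism of
Frobenius type; pre-step; pull-back morphism) of `C^istr` to an isomorphic object (respectively,
abstractly equivalent morphism; …) of `C`."  Proof (p. 51): "the remainder of properties (b), (c),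
(d) follows immediately from the construction of `Ψ₁`, `Ψ₂` … [cf. also Remark 2.5.1; Proposition
1.10, (i); Definition 1.3, (ii); … Proposition 2.1, (iii)]."

Made explicit: for `φ : A → B` between isotropic objects write `φ = ζ_A(n) ; β ; α` (normal form,
`UnitLinearIsotropic.lean`) with `β = β₀ · β₁` (`β₀` a unit, `β₁ ∈ τ'(A)`); then
`φ ; ζ_B(d) = ζ_A(d) ; χ'` with `χ' := ζ_A(n) ; β^d · v ; α` for a unit `v` (Prop. 1.11 (iii),
Def. 1.3 (ii), Frobenius-normalisation), and `χ' = Ψ_ul(χ)` for `χ := ζ_A(n) ; β₀^d · v · β₁ ; α`;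
hence `Ψ(φ) = Ψ_ul⁻¹(Ψ₁ φ)` is abstractly equivalent to `χ` (`isAbstractlyEquivalent_of_conj`), and
`χ` is abstractly equivalent to `φ` when `φ` is linear (left factor the unit `β₀^{d-1} · v`) or of
Frobenius type (right factor a unit conjugated by the isomorphism `α`) (`unitWiseFrobenius_arrows`).

Provenance: typed/proved by abc-iut-L6-t9 (prover-abc-iut-L6-t9-g0-0; staged HOME/staging/L1/L6-t9/,
MANIFEST.txt, session ended 2026-08-25T23:52Z inviting any seat to file verbatim); filed verbatim by
abc-iut-w5-d248 as filer-of-record (L1-lead ruling R82 (4), 2026-08-26T00:16:47Z) after re-verification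
against the current tree (only change: fully-qualified closing types where applicable, and this note).
-/

noncomputable section

namespace Literature.AlgebraicGeometry.Frobenioids

open CategoryTheory Opposite

universe w v v' u u'

namespace PreFrobenioid

variable {D : Type u} [Category.{v} D] {Φ : Dᵒᵖ ⥤ CommMonCat.{w}}
  {C : Type u'} [Category.{v'} C] {F : C ⥤ ElemFrobenioid Φ}

/-- A unit of `O^▷(A)` as an automorphism of `A`. [cite: MochizukiFrdI2008, Def. 1.2(ii) p.22] -/
theorem exists_iso_of_isUnit {A : C} {u : endSubmonoid F A} (hu : IsUnit u) :
    ∃ e : A ≅ A, e.hom = u.1 := by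
  obtain ⟨α, -, hα⟩ := (isUnit_endSubmonoid_iff F u).mp hu
  exact ⟨α, hα⟩

namespace CharacteristicSplitting

variable (hF : IsFrobenioid F) (τ : CharacteristicSplitting F) (hmt : IsOfType (IsMetricallyTrivial F))
  (haa : IsOfType (IsAutAmple F)) (hnorm : IsOfType (IsFrobeniusNormalized F)) (d : ℕ+)
  (ch : FrobeniusChoice F d)

include hF τ hmt haa hnorm d ch

omit hnorm ch in
/-- `β₁^d` for `β₁ ∈ τ'(A)` and `δ = d · (−)` is the `d`-th power. [cite: MochizukiFrdI2008, Prop. 2.5(iii) p.50] -/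
theorem tauPow_eq_pow {A : C} {t : endSubmonoid F A} (ht : t ∈ liftedTau hF τ A) :
    tauPow hF τ hmt haa (powEnd Φ d) A t = t ^ (d : ℕ) :=
  tauPow_eq hF τ hmt haa _ (pow_mem ht _) (by rw [map_pow]; rfl)

/-- **`Ψ(φ)` is abstractly equivalent to `χ` whenever `ζ_A(d) ; Ψ_ul(χ) = φ ; ζ_B(d)`** for base-identity
endomorphisms of Frobenius type `ζ_A(d), ζ_B(d)` of degree `d` (`A, B` arbitrary): the chosen
`α_A, α_B` of `Ψ₁` differ from `ζ_A(d), ζ_B(d)` by isomorphisms (Def. 1.3 (ii)), `Ψ₁(φ)` is then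
`Ψ_ul` of the conjugate of `χ`, and `Ψ_ul⁻¹ Ψ_ul ≅ id`. [cite: MochizukiFrdI2008, Cor. 2.6 p.51] -/
theorem isAbstractlyEquivalent_of_conj {A B : C} {zA : A ⟶ A} {zB : B ⟶ B}
    (hzAf : IsFrobeniusType F zA) (hzAd : degFr F zA = d) (hzBf : IsFrobeniusType F zB)
    (hzBd : degFr F zB = d) (φ χ : A ⟶ B)
    (h : zA ≫ unitLinearMap hF τ hmt haa (powEnd Φ d) hnorm χ = φ ≫ zB) :
    IsAbstractlyEquivalent ((unitWiseFrobenius hF τ hmt haa hnorm d ch).map φ) χ := by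
  letI := isEquivalence_unitLinear hF τ hmt haa hnorm d
  have hP := hF.isPreFrobenioid
  have hl := hasFrobeniusLifts hF d
  obtain ⟨eA, heA⟩ := hF.ii_unique (ch.hom A) zA (ch.isFrobeniusType A) hzAf ((ch.degFr_eq A).trans hzAd.symm)
  obtain ⟨eB, heB⟩ := hF.ii_unique (ch.hom B) zB (ch.isFrobeniusType B) hzBf ((ch.degFr_eq B).trans hzBd.symm)
  -- `Ψ₁(φ) = Ψ_ul(e_A ; χ ; e_B⁻¹)`
  have hlift : ch.lift hl φ = eA.hom ≫ unitLinearMap hF τ hmt haa (powEnd Φ d) hnorm χ ≫ eB.inv := by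
    refine (ch.lift_unique hl φ _ ?_).symm
    rw [reassoc_of% heA, reassoc_of% h, ← heB, Category.assoc, eB.hom_inv_id, Category.comp_id]
  have hmap : (naiveFrobeniusCd ch hl).map φ =
      (unitLinearFrobeniusData hF τ hmt haa (powEnd Φ d) hnorm).functor.map (eA.hom ≫ χ ≫ eB.inv) := by
    apply InducedWideCategory.Hom.ext
    show ch.lift hl φ = unitLinearMap hF τ hmt haa (powEnd Φ d) hnorm (eA.hom ≫ χ ≫ eB.inv)
    rw [hlift, unitLinearMap_comp, unitLinearMap_comp,
      unitLinearMap_of_isIsometry hF τ hmt haa _ hnorm (isIsometry_of_isIso F hP eA.hom),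
      unitLinearMap_of_isIsometry hF τ hmt haa _ hnorm (isIsometry_of_isIso F hP eB.inv)]
  have hΨφ : (unitWiseFrobenius hF τ hmt haa hnorm d ch).map φ =
      (unitLinearFrobeniusData hF τ hmt haa (powEnd Φ d) hnorm).functor.inv.map
        ((unitLinearFrobeniusData hF τ hmt haa (powEnd Φ d) hnorm).functor.map (eA.hom ≫ χ ≫ eB.inv)) :=
    congrArg (fun x => (unitLinearFrobeniusData hF τ hmt haa (powEnd Φ d) hnorm).functor.inv.map x) hmap
  rw [hΨφ]
  let e := (unitLinearFrobeniusData hF τ hmt haa (powEnd Φ d) hnorm).functor.asEquivalence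
  -- `Ψ_ul⁻¹(Ψ_ul g) ≅ g` (unit of the equivalence) and `g = e_A ; χ ; e_B⁻¹ ≅ χ`
  refine ⟨Arrow.isoMk
      (f := Arrow.mk ((unitLinearFrobeniusData hF τ hmt haa (powEnd Φ d) hnorm).functor.inv.map
        ((unitLinearFrobeniusData hF τ hmt haa (powEnd Φ d) hnorm).functor.map (eA.hom ≫ χ ≫ eB.inv))))
      (g := Arrow.mk (eA.hom ≫ χ ≫ eB.inv)) (e.unitIso.app (ch.obj A)).symm
      (e.unitIso.app (ch.obj B)).symm (e.unitInv.naturality (eA.hom ≫ χ ≫ eB.inv)).symm ≪≫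
    Arrow.isoMk (f := Arrow.mk (eA.hom ≫ χ ≫ eB.inv)) (g := Arrow.mk χ) eA eB ?_⟩
  show eA.hom ≫ χ = (eA.hom ≫ χ ≫ eB.inv) ≫ eB.hom
  rw [Category.assoc, Category.assoc, eB.inv_hom_id, Category.comp_id]

omit τ hmt haa ch in
/-- The `ζ`-conjugate of an arrow out of an isotropic object: for `φ = ζ_A(n) ; β ; α` (`β ∈ O^▷(A)`,
`α` a pull-back morphism, `ζ_A` a Frobenius section of `A`) and `ζ_B(d)` a base-identity endomorphism
of Frobenius type of degree `d` of `B`, there is a unit `v` of `O^▷(A)` with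
`φ ; ζ_B(d) = ζ_A(d) ; ζ_A(n) ; β^d · v ; α` (lift `ζ_B(d)` along `α`, Prop. 1.11 (iii); compare with
`ζ_A(d)`, Def. 1.3 (ii); Frobenius-normalisation). [cite: MochizukiFrdI2008, Cor. 2.6 p.51] -/
theorem exists_zeta_conjugate {A B : C} (ζ : ℕ+ →* End A)
    (hζ : ∀ n, degFr F (ζ n) = n ∧ IsBaseIdentity F (ζ n) ∧ IsFrobeniusType F (ζ n))
    (n : ℕ+) (β : endSubmonoid F A) {α : A ⟶ B} (hα : IsPullbackMorphism F α) {zB : B ⟶ B}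
    (hzBb : IsBaseIdentity F zB) (hzBf : IsFrobeniusType F zB) (hzBd : degFr F zB = d) :
    ∃ v : endSubmonoid F A, IsUnit v ∧
      ((ζ n : A ⟶ A) ≫ (β.1 : A ⟶ A) ≫ α) ≫ zB =
        (ζ d : A ⟶ A) ≫ (ζ n : A ⟶ A) ≫ ((v * β ^ (d : ℕ)).1 : A ⟶ A) ≫ α := by
  obtain ⟨z'', hz''b, hz''f, hz''d, hsq⟩ := exists_frobeniusType_lift hF hα hzBb hzBf
  obtain ⟨v, hv, hzv⟩ := exists_unit_of_isFrobeniusType_degFr_eq hF (hζ d).2.1 (hζ d).2.2 hz''b hz''f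
    ((hζ d).1.trans (hz''d.trans hzBd).symm)
  refine ⟨v, hv, ?_⟩
  have hcomm : (ζ n : A ⟶ A) ≫ (ζ d : A ⟶ A) = (ζ d : A ⟶ A) ≫ (ζ n : A ⟶ A) := by
    show (ζ d * ζ n : End A) = ζ n * ζ d
    rw [← map_mul, ← map_mul, mul_comm]
  have hnz := comp_eq_comp_pow_of_isFrobeniusNormalized (hnorm A) (hζ d).2.1 β
  rw [(hζ d).1] at hnz
  rw [Submonoid.coe_mul, End.mul_def]
  simp only [Category.assoc]
  rw [hsq, hzv]
  simp only [Category.assoc]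
  rw [reassoc_of% hnz, reassoc_of% hcomm]

/-- **Cor. 2.6 (b), arrows**: `Ψ` maps a morphism of Frobenius type, a pre-step or a pull-back morphism
between isotropic objects to an abstractly equivalent arrow.
[cite: MochizukiFrdI2008, Cor. 2.6 p.50] -/
theorem unitWiseFrobenius_arrows {A B : C} (φ : A ⟶ B) (hA : IsIsotropic F A) (hB : IsIsotropic F B)
    (hφ : IsFrobeniusType F φ ∨ IsPreStep F φ ∨ IsPullbackMorphism F φ) :
    IsAbstractlyEquivalent ((unitWiseFrobenius hF τ hmt haa hnorm d ch).map φ) φ := by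
  have hP := hF.isPreFrobenioid
  -- Frobenius sections of `A` and `B` (Prop. 2.5 (ii))
  obtain ⟨ζ, hζ⟩ : IsFrobeniusTrivial F A :=
    (isFrobeniusTrivial_istr_iff hF ⟨A, hA⟩).mp (isOfType_isFrobeniusTrivial_istr hF hmt ⟨A, hA⟩)
  obtain ⟨ζB, hζB⟩ : IsFrobeniusTrivial F B :=
    (isFrobeniusTrivial_istr_iff hF ⟨B, hB⟩).mp (isOfType_isFrobeniusTrivial_istr hF hmt ⟨B, hB⟩)
  -- normal form `φ = ζ(n) ; β ; α`
  obtain ⟨z, β₀, α, hzb, hzf, hα, hfac⟩ := exists_normalForm hF hmt haa hA φ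
  set n := degFr F z with hn
  obtain ⟨v₀, hv₀, hzv₀⟩ := exists_unit_of_isFrobeniusType_degFr_eq hF (hζ n).2.1 (hζ n).2.2 hzb hzf (hζ n).1
  -- absorb `v₀` into `β`
  let β : endSubmonoid F A := β₀ * v₀
  have hfac' : (ζ n : A ⟶ A) ≫ (β.1 : A ⟶ A) ≫ α = φ := by
    rw [← hfac, hzv₀, Submonoid.coe_mul, End.mul_def]; simp only [Category.assoc]
  obtain ⟨⟨-, hαi⟩, hαl⟩ := hF.iv_b α hα
  -- the `ζ`-conjugate `χ' = ζ(n) ; β^d v ; α` and `χ = ζ(n) ; β₀'^d v t ; α`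
  obtain ⟨v, hv, hconj⟩ := exists_zeta_conjugate hF hnorm d ζ hζ n β hα (hζB d).2.1
    (hζB d).2.2 (hζB d).1
  obtain ⟨t, ht, u, hu, hβut⟩ := exists_liftedTau_split hF τ β
  let γ : endSubmonoid F A := u ^ (d : ℕ) * v * t
  have hct : Commute u t := endSubmonoid_comm F hF u t
  have hΨγ : unitLinearPow hF τ hmt haa (powEnd Φ d) A γ = v * β ^ (d : ℕ) := by
    rw [unitLinearPow_eq hF τ hmt haa (powEnd Φ d) ((hu.pow _).mul hv) ht rfl,
      tauPow_eq_pow hF τ hmt haa d ht, hβut, hct.mul_pow, endSubmonoid_comm F hF (u ^ (d : ℕ)) v,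
      mul_assoc]
  let χ : A ⟶ B := (ζ n : A ⟶ A) ≫ (γ.1 : A ⟶ A) ≫ α
  have hχ : (ζ d : A ⟶ A) ≫ unitLinearMap hF τ hmt haa (powEnd Φ d) hnorm χ = φ ≫ (ζB d : B ⟶ B) := by
    rw [unitLinearMap_eq_of_factorization hF τ hmt haa _ hnorm (hζ n).2.2.1.2 γ hαi, hΨγ, ← hfac', hconj]
  have h1 : IsAbstractlyEquivalent ((unitWiseFrobenius hF τ hmt haa hnorm d ch).map φ) χ :=
    isAbstractlyEquivalent_of_conj hF τ hmt haa hnorm d ch (hζ d).2.2 (hζ d).1 (hζB d).2.2 (hζB d).1 φ χ hχ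
  refine h1.trans ?_
  -- `χ` is abstractly equivalent to `φ`
  have hd1 : (d : ℕ) = (d : ℕ) - 1 + 1 := (Nat.sub_add_cancel d.pos).symm
  rcases hφ with hft | hlin
  · -- Frobenius type: `β` is a unit (`t = 1`), `α` an isomorphism; correct on the right
    have hβunit : IsUnit β := by
      rw [← associated_one_iff_isUnit, ← div_eq_div_iff_associated F hF, map_one,
        ← div_normalForm (hζ n).2.1 (hζ n).2.2.1.2 β hαi hαl, hfac']
      exact hft.1.2
    have ht1 : t = 1 := by
      apply liftedTau_eq_of_div_eq hF τ ht (one_mem _)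
      rw [map_one, ← divHom_eq_one_of_isUnit F hP hβunit, hβut, map_mul,
        divHom_eq_one_of_isUnit F hP hu, one_mul]
    have hφb : IsBaseIso F ((ζ n : A ⟶ A) ≫ (β.1 : A ⟶ A) ≫ α) := by rw [hfac']; exact hft.2
    have hαb : IsBaseIso F α := (isBaseIso_factors F hP.isTotallyEpimorphic_base
      (isBaseIso_factors F hP.isTotallyEpimorphic_base hφb).1).1
    have hαiso : IsIso α := (isPullbackMorphism_and_isBaseIso_iff_isIso F α).mp ⟨hα, hαb⟩
    -- the unit `w' := β · (u^d v)⁻¹` with `(u^d v) ; w' = β`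
    have hγu : IsUnit γ := by rw [show γ = u ^ (d : ℕ) * v * t from rfl, ht1, mul_one]; exact (hu.pow _).mul hv
    obtain ⟨gi, hgi⟩ := hγu
    obtain ⟨W, hW⟩ := exists_iso_of_isUnit (F := F) (u := β * ↑gi⁻¹) (hβunit.mul (gi⁻¹).isUnit)
    refine ⟨Arrow.isoMk (f := Arrow.mk χ) (g := Arrow.mk φ) (Iso.refl A)
      ((@asIso _ _ _ _ α hαiso).symm ≪≫ W ≪≫ @asIso _ _ _ _ α hαiso) ?_⟩
    show 𝟙 A ≫ φ = χ ≫ (@inv _ _ _ _ α hαiso ≫ W.hom ≫ α)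
    rw [Category.id_comp, ← hfac', hW]
    show _ = ((ζ n : A ⟶ A) ≫ (γ.1 : A ⟶ A) ≫ α) ≫ inv α ≫ ((β * ↑gi⁻¹).1 : A ⟶ A) ≫ α
    simp only [Category.assoc, @IsIso.hom_inv_id_assoc _ _ _ _ α hαiso]
    rw [← Category.assoc (γ.1 : A ⟶ A), ← End.mul_def, ← Submonoid.coe_mul, ← hgi, mul_assoc,
      Units.inv_mul, mul_one]
  · -- linear (pre-step or pull-back): `n = 1`, correct on the left by the unit `u^{d-1} v`
    have hlinφ : IsLinear F φ := hlin.elim (fun h => h.1) (fun h => (hF.iv_b φ h).2)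
    have hn1 : n = 1 := by
      have := degFr_normalForm (ζ n : A ⟶ A) β hαl
      rw [hfac', (hζ n).1] at this
      rw [← this]; exact hlinφ
    have hζ1 : (ζ n : A ⟶ A) = 𝟙 A := by rw [hn1, map_one]; rfl
    obtain ⟨W, hW⟩ := exists_iso_of_isUnit (F := F) (u := u ^ ((d : ℕ) - 1) * v) ((hu.pow _).mul hv)
    have hγ' : β * (u ^ ((d : ℕ) - 1) * v) = γ := by
      show β * (u ^ ((d : ℕ) - 1) * v) = u ^ (d : ℕ) * v * t
      rw [hβut, mul_assoc, endSubmonoid_comm F hF t (u ^ ((d : ℕ) - 1) * v), ← mul_assoc, ← mul_assoc,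
        ← pow_succ', ← hd1]
    refine ⟨Arrow.isoMk (f := Arrow.mk χ) (g := Arrow.mk φ) W (Iso.refl B) ?_⟩
    show W.hom ≫ φ = ((ζ n : A ⟶ A) ≫ (γ.1 : A ⟶ A) ≫ α) ≫ 𝟙 B
    rw [Category.comp_id, ← hfac', hW, hζ1, Category.id_comp, Category.id_comp, ← Category.assoc,
      ← End.mul_def, ← Submonoid.coe_mul, hγ']

end CharacteristicSplitting

end PreFrobenioid

end Literature.AlgebraicGeometry.Frobenioids
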